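import Literature.AlgebraicGeometry.Resolution.StrictTransformLocality
import Literature.AlgebraicGeometry.Resolution.StrictTransformIsBlowup
import HarnessLib

/-!
# The strict transform along a blowing up is local on the blow-up

Topic: `Literature/AlgebraicGeometry/Resolution`. For `f : X → S`, a morphism `b : S' → S` with
`b⁻¹𝓘 𝒪_{S'}` an effective Cartier divisor (a blowing up in `𝓘`) and an open immersion
`j : V → S'`, the strict transform (Stacks 080D (2), `blowupStrictTransform`) of `X` along
`j ≫ b : V → S` is the open piece of the strict transform `X'` of `X` along `b` lying over `V`:
the square

  `X'_V ⟶ X'`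
  ` ↓      ↓ `
  ` V  ⟶  S'`

is cartesian. Consequently a property of morphisms which is Zariski-local on the target (e.g.
`Flat`, `LocallyOfFinitePresentation`) holds for `X' → S'` as soon as it holds for the strict
transforms along the members `Vᵢ → S' → S` of an open cover of `S'` — the reduction "the
question is local on `S'`" used throughout Stacks 080C–081R.

* `strictTransformOverι j` — the open immersion `X ×_S V ↪ X ×_S S'`, with `_snd`, `_fst`,
  `range_strictTransformOverι`;
* `ker_blowupStrictTransformι_over` — locality of the ideal of the strict transform under
  restriction of `S'` to `V`;
* `isPullback_blowupStrictTransform_over` — the cartesian square above (for the model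
  `V((𝒦.comap ·))` of `X'_V`);
* `blowupStrictTransformMap_of_openCover_target` — **`P` Zariski-local on the target holds for
  `X' → S'` if it holds for the strict transforms along `𝒰ᵢ → S' → S`, `𝒰` an open cover of `S'`.**

## References

* The Stacks Project, Tag 080C ("The question is local on `X`"), Tag 080D, Tag 081R.
  [StacksProject]
-/

noncomputable section

open CategoryTheory CategoryTheory.Limits AlgebraicGeometry TopologicalSpace

namespace Literature.AlgebraicGeometry.Resolution

universe u

section Over

variable {X S S' V : Scheme.{u}} (f : X ⟶ S) (b : S' ⟶ S) (I : S.IdealSheafData) (j : V ⟶ S')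

/-- The open immersion `X ×_S V ↪ X ×_S S'` over an open immersion `j : V → S'` (the base change
of `j` along the second projection, through `(X ×_S S') ×_{S'} V ≅ X ×_S V`). [folklore] -/
def strictTransformOverι : pullback f (j ≫ b) ⟶ pullback f b :=
  (pullbackLeftPullbackSndIso f b j).inv ≫ pullback.fst (pullback.snd f b) j

/-- `X ×_S V ↪ X ×_S S'` is an open immersion for `j` an open immersion. [folklore] -/
instance isOpenImmersion_strictTransformOverι [IsOpenImmersion j] :
    IsOpenImmersion (strictTransformOverι f b j) := by
  unfold strictTransformOverι
  infer_instance

/-- `X ×_S V ↪ X ×_S S' → S'` is the second projection followed by `j`. [folklore] -/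
@[reassoc]
theorem strictTransformOverι_snd :
    strictTransformOverι f b j ≫ pullback.snd f b = pullback.snd f (j ≫ b) ≫ j := by
  rw [strictTransformOverι, Category.assoc, pullbackLeftPullbackSndIso_inv_fst_snd]

/-- `X ×_S V ↪ X ×_S S' → X` is the first projection. [folklore] -/
@[reassoc]
theorem strictTransformOverι_fst :
    strictTransformOverι f b j ≫ pullback.fst f b = pullback.fst f (j ≫ b) := by
  rw [strictTransformOverι, Category.assoc, pullbackLeftPullbackSndIso_inv_fst]

/-- The image of `X ×_S V ↪ X ×_S S'` is the preimage of the image of `j`. [folklore] -/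
theorem range_strictTransformOverι :
    Set.range (strictTransformOverι f b j) = (pullback.snd f b) ⁻¹' Set.range j := by
  rw [strictTransformOverι, Scheme.Hom.comp_base, TopCat.coe_comp, Set.range_comp,
    Set.range_eq_univ.mpr (ConcreteCategory.bijective_of_isIso _).2, Set.image_univ,
    Scheme.Pullback.range_fst]

/-- **Locality of the ideal of the strict transform on the blow-up**: the ideal of the strict
transform of `X` along `V → S' → S` (`j : V → S'` an open immersion) is the restriction of
the ideal of the strict transform along `S' → S`, provided `b⁻¹𝓘 𝒪_{S'}` is an effective
Cartier divisor. [cite: StacksProject, Tag 080C] -/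
theorem ker_blowupStrictTransformι_over [IsOpenImmersion j] (hE : IsEffectiveCartier (I.comap b)) :
    ((pullback.snd f (j ≫ b)) ⁻¹ᵁ ((j ≫ b) ⁻¹ᵁ centreCompl I)).ι.ker =
      ((pullback.snd f b) ⁻¹ᵁ (b ⁻¹ᵁ centreCompl I)).ι.ker.comap (strictTransformOverι f b j) := by
  haveI : QuasiCompact ((pullback.snd f b) ⁻¹ᵁ (b ⁻¹ᵁ centreCompl I)).ι := by
    rw [preimage_centreCompl]
    exact quasiCompact_ι_preimage_centreCompl _ hE
  refine ker_ι_preimage_eq_comap (strictTransformOverι f b j) _ _ ?_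
  show (pullback.snd f (j ≫ b) ≫ j ≫ b) ⁻¹ᵁ centreCompl I =
    strictTransformOverι f b j ⁻¹ᵁ (pullback.snd f b) ⁻¹ᵁ (b ⁻¹ᵁ centreCompl I)
  rw [← Category.assoc, ← strictTransformOverι_snd]
  rfl

/-- **The strict transform over an open `V ⊆ S'` is the open piece of the strict transform over
`V`**: with `𝒦` the ideal of `X' ⊆ X ×_S S'`, the closed subscheme `V(𝒦|_{X ×_S V})` of
`X ×_S V` (which is the strict transform of `X` along `V → S`, `ker_blowupStrictTransformι_over`)
sits in a cartesian square over `V → S'` with `X' = V(𝒦) → S'`. [cite: StacksProject, Tag 080C] -/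
theorem isPullback_blowupStrictTransform_over [IsOpenImmersion j] :
    IsPullback
      ((((pullback.snd f b) ⁻¹ᵁ (b ⁻¹ᵁ centreCompl I)).ι.ker.comapIso
          (strictTransformOverι f b j)).hom ≫
        pullback.snd (strictTransformOverι f b j)
          ((pullback.snd f b) ⁻¹ᵁ (b ⁻¹ᵁ centreCompl I)).ι.ker.subschemeι)
      ((((pullback.snd f b) ⁻¹ᵁ (b ⁻¹ᵁ centreCompl I)).ι.ker.comap
          (strictTransformOverι f b j)).subschemeι ≫ pullback.snd f (j ≫ b))
      (((pullback.snd f b) ⁻¹ᵁ (b ⁻¹ᵁ centreCompl I)).ι.ker.subschemeι ≫ pullback.snd f b) j := by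
  have hcomm : ((((pullback.snd f b) ⁻¹ᵁ (b ⁻¹ᵁ centreCompl I)).ι.ker.comapIso
      (strictTransformOverι f b j)).hom ≫
        pullback.snd (strictTransformOverι f b j)
          ((pullback.snd f b) ⁻¹ᵁ (b ⁻¹ᵁ centreCompl I)).ι.ker.subschemeι) ≫
      (((pullback.snd f b) ⁻¹ᵁ (b ⁻¹ᵁ centreCompl I)).ι.ker.subschemeι ≫ pullback.snd f b) =
      ((((pullback.snd f b) ⁻¹ᵁ (b ⁻¹ᵁ centreCompl I)).ι.ker.comap
          (strictTransformOverι f b j)).subschemeι ≫ pullback.snd f (j ≫ b)) ≫ j := by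
    rw [Category.assoc, ← pullback.condition_assoc, strictTransformOverι_snd, ← Category.assoc,
      ← Category.assoc, Scheme.IdealSheafData.comapIso_hom_fst, Category.assoc]
  have hrange : (((pullback.snd f b) ⁻¹ᵁ (b ⁻¹ᵁ centreCompl I)).ι.ker.subschemeι ≫
      pullback.snd f b) ⁻¹ᵁ Scheme.Hom.opensRange j =
      Scheme.Hom.opensRange ((((pullback.snd f b) ⁻¹ᵁ (b ⁻¹ᵁ centreCompl I)).ι.ker.comapIso
        (strictTransformOverι f b j)).hom ≫
          pullback.snd (strictTransformOverι f b j)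
            ((pullback.snd f b) ⁻¹ᵁ (b ⁻¹ᵁ centreCompl I)).ι.ker.subschemeι) := by
    rw [Scheme.Hom.opensRange_comp_of_isIso]
    apply Opens.ext
    change ((((pullback.snd f b) ⁻¹ᵁ (b ⁻¹ᵁ centreCompl I)).ι.ker.subschemeι ≫
      pullback.snd f b)) ⁻¹' Set.range j = Set.range (pullback.snd (strictTransformOverι f b j)
        ((pullback.snd f b) ⁻¹ᵁ (b ⁻¹ᵁ centreCompl I)).ι.ker.subschemeι)
    rw [Scheme.Pullback.range_snd, range_strictTransformOverι, ← Set.preimage_comp]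
    ext x
    simp only [Set.mem_preimage, Function.comp_apply, ← Scheme.Hom.comp_apply]
  exact (IsOpenImmersion.isPullback _ _ j _ hcomm hrange).flip

end Over

/-- **A property of morphisms which is Zariski-local on the target holds for the strict
transform `X' → S'` as soon as it holds for the strict transforms of `X` along the members
`𝒰ᵢ → S' → S` of an open cover `𝒰` of `S'`** (`b⁻¹𝓘 𝒪_{S'}` an effective Cartier divisor);
e.g. `P = Flat`, `P = LocallyOfFinitePresentation`: "the question is local on `S'`".
[cite: StacksProject, Tag 080C] -/
theorem blowupStrictTransformMap_of_openCover_target {X S S' : Scheme.{u}} (f : X ⟶ S)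
    (b : S' ⟶ S) (I : S.IdealSheafData) (P : MorphismProperty Scheme.{u})
    [IsZariskiLocalAtTarget P] (hE : IsEffectiveCartier (I.comap b)) (𝒰 : S'.OpenCover)
    (H : ∀ i, P (blowupStrictTransformMap f (𝒰.f i ≫ b) I)) :
    P (blowupStrictTransformMap f b I) := by
  change P (((pullback.snd f b) ⁻¹ᵁ (b ⁻¹ᵁ centreCompl I)).ι.ker.subschemeι ≫ pullback.snd f b)
  refine IsZariskiLocalAtTarget.of_openCover 𝒰 fun i => ?_
  have h := isPullback_blowupStrictTransform_over f b I (𝒰.f i)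
  show P (pullback.snd (((pullback.snd f b) ⁻¹ᵁ (b ⁻¹ᵁ centreCompl I)).ι.ker.subschemeι ≫
    pullback.snd f b) (𝒰.f i))
  rw [← P.cancel_left_of_respectsIso h.isoPullback.hom, h.isoPullback_hom_snd,
    ← ker_blowupStrictTransformι_over f b I (𝒰.f i) hE]
  exact H i

end Literature.AlgebraicGeometry.Resolution

end
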